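import Summits.QuantumFields.GaugeBoot.ClassBStrongCoupling
import Summits.QuantumFields.GaugeBoot.DiagonalRPTorusInnerHalf
import HarnessLib

/-!
# Diagonal RP of torus limit points from inner-half diagonal RP of large tori (gauge-boot, L3(ι), I)

HONEST FRAMING (cell `pub-gaugeboot`, page 1 of every file): the venture produces certified bounds
on lattice expectations at stated coupling, gauge group, dimension and torus size; NOT a mass gap,
NOT a continuum limit, NOT a string tension; NOT Yang–Mills-summit-bearing (barriers
`FixedCouplingUltralocality`, `PerturbativeInvisibility`). This module is a structural lemma about
the thermodynamic limit (which positivity families limit states of the torus Wilson states carry);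
it changes no certificate, and no certificate with a diagonal block on a torus exists or is planned.

## Content

`ClassB.lean` carries, as an OPEN `Prop`, the identification `ThermodynamicLimitIsClassB d ρ β`:
every infinite-volume limit point of the torus Wilson states (`infiniteVolumeLimitPoints ρ β`,
limits along tori `(ℤ/L)^d`, `L → ∞` through any subsequence) is a Class-B state — translation and
hyperoctahedral invariance, the one-link Haar-shift identity, reflection positivity in the site,
link AND diagonal mirrors. By `thermodynamicLimitIsClassB_iff` (`ClassBIdentification.lean`) it is
equivalent, for `β ≥ 0`, to the diagonal RP of the limit points, `TorusLimitPointsDiagonalRP d ρ β`,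
so far known in the tree only where the DLR state is unique
(`thermodynamicLimitIsClassB_of_subsingleton`); the obstruction being that the finite tori
themselves violate closed-half diagonal RP (`not_diagonalReflectionPositive`).

**The transfer** (every `d`, every real `β`; `diagRP_of_mem_infiniteVolumeLimitPoints_of_innerDiagonalRP`,
`torusLimitPointsDiagonalRP_of_innerDiagonalRP`, `thermodynamicLimitIsClassB_of_innerDiagonalRP`):
if INNER-half diagonal RP (`InnerDiagonalRP`, `DiagonalRPTorusInnerHalf.lean`: bounded measurable
observables of the closed half `{0 ≤ (y_i - y_j) mod L ≤ L/2}` not meeting its back layer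
`y_i - y_j ≡ L/2`) holds on all large tori `(ℤ/(L+1))^d`, then every infinite-volume limit point is
reflection positive in the diagonal mirror `x_i = x_j` (`ClassB.lean`'s `IsReflectionPositiveFor
(configDiagSwapZd i j) (diagHalfEdges i j)`), hence — for `β ≥ 0` — a Class-B state. The back layer
recedes to infinity with `L`; a local observable never meets it. The hypothesis is a THEOREM for
`d = 2` (L3(η) even tori, L3(θ) odd tori): `ClassBTwoDimensional.lean` concludes Class B in two
dimensions from this file. For `d ≥ 3` the hypothesis is open and nothing is claimed.

## Proof

As in `ClassBLimitLinkRP.lean` (link RP of limit points) with the diagonal swap in place of the link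
reflection: by `IsReflectionPositiveFor.of_continuous_cylinder` (`ClassBRPClosure.lean`; the swap
`configDiagSwapZd i j = configPerm (swap i j)` preserves every limit point,
`permInvariant_of_mem_infiniteVolumeLimitPoints`) it suffices to treat a bounded continuous
cylinder observable `F` supported on finitely many links of the closed half `diagHalfEdges i j`,
say with `0 ≤ x_i - x_j ≤ m`. The periodic lift intertwines the swaps of `ℤ^d` and of the torus
(`torusLift_configDiagSwap`), and for `m + 2 ≤ L/2` the lift of `F` has torus diagonal coordinate
`(y_i - y_j) mod L ∈ [0, m + 1] < L/2` at both endpoints of each of its links, i.e. it is an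
inner-half observable (`isInnerHalfObservable_toTorusObservable`); so the torus pairings along the
defining subsequence are eventually non-negative and so is their limit `∫ (F∘Θ)‾ F dμ` (real and
imaginary parts separately, `integral_diagSwap_nonneg_of_cylinder_of_innerDiagonalRP`).

References: K. Osterwalder, E. Seiler, Ann. Phys. 110 (1978) 440, §2; E. Seiler, LNP 159 (1982)
Ch. 2; J. Glimm, A. Jaffe, Quantum Physics (1987) §6.1 (RP passes to limits); V. Kazakov, Z. Zheng,
arXiv:2203.11360 §3.1 (the three RP families of the lattice bootstrap).
-/

noncomputable section

open MeasureTheory Filter Topology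
open scoped ComplexOrder ComplexConjugate
open Literature.Probability.LatticeModels (Site Torus.proj Torus.proj_apply)
open Literature.MathematicalPhysics.QuantumLattice
open Literature.MathematicalPhysics.QuantumFieldTheory (GaugeConfig Edge wilsonExpectation
  wilsonMeasure isProbabilityMeasure_wilsonMeasure measurable_torusLift)

namespace Summit.QuantumFields.GaugeBoot

variable {d N : ℕ} {G : Type*}

/-! ## The diagonal swap on `ℤ^d` and on the torus -/

section DiagMaps

/-- **The periodic lift intertwines the diagonal swaps** of the torus (`configDiagSwap`) and of
`ℤ^d` (`configDiagSwapZd`): `torusLift L (Θ U) = Θ (torusLift L U)`. -/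
theorem torusLift_configDiagSwap (L : ℕ) (i j : Fin d) (U : GaugeConfig d L G) :
    torusLift L (configDiagSwap i j U) = configDiagSwapZd i j (torusLift L U) := by
  funext e
  simp only [torusLift, Function.comp_apply, torusEdge, configDiagSwapZd, configDiagSwap,
    edgeDiagSwap]
  congr 2

/-- Observable form of `torusLift_configDiagSwap`. -/
theorem toTorusObservable_comp_configDiagSwapZd {α : Type*} (L : ℕ) (i j : Fin d)
    (F : LGConfig d G → α) :
    toTorusObservable L (F ∘ configDiagSwapZd i j) = toTorusObservable L F ∘ configDiagSwap i j := by
  funext U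
  simp only [toTorusObservable, Function.comp_apply, torusLift_configDiagSwap]

/-- A cylinder observable stays a cylinder observable under the diagonal swap of `ℤ^d`. -/
theorem isCylinder_comp_configDiagSwapZd {α : Type*} {F : LGConfig d G → α}
    {S : Finset (ZdEdge d)} (hF : IsCylinder F S) (i j : Fin d) :
    IsCylinder (F ∘ configDiagSwapZd i j)
      (S.image fun e => (zdDiagSwap i j e.1, Equiv.swap i j e.2)) := by
  intro U V hUV
  apply hF
  intro e he
  exact hUV _ (Finset.mem_coe.2 (Finset.mem_image_of_mem
    (fun e : ZdEdge d => (zdDiagSwap i j e.1, Equiv.swap i j e.2)) (Finset.mem_coe.1 he)))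

end DiagMaps

/-! ## Lifting a finitely supported diagonal-half observable to a large torus -/

section Support

/-- The torus diagonal coordinate `(y_i - y_j) mod L` of the projection of a site with
`0 ≤ x_i - x_j < L` is `x_i - x_j`. -/
theorem val_torusProj_sub {L : ℕ} [NeZero L] (i j : Fin d) {x : Site d} (h0 : 0 ≤ x i - x j)
    (hL : x i - x j < L) : (((Torus.proj L x) i - (Torus.proj L x) j).val : ℤ) = x i - x j := by
  simp only [Torus.proj_apply]
  rw [← Int.cast_sub, ZMod.val_intCast, Int.emod_eq_of_lt h0 hL]

/-- The diagonal coordinate of the endpoint `x + e_k` of a link `(x, k)` of the closed half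
`{x_i ≥ x_j}` with `x_i - x_j ≤ m` lies in `[0, m + 1]`. -/
theorem diag_endpoint_bounds {i j : Fin d} {e : ZdEdge d} (he : e ∈ diagHalfEdges i j) {m : ℕ}
    (hm : e.1 i - e.1 j ≤ m) :
    0 ≤ (e.1 + Pi.single e.2 (1 : ℤ) : Site d) i - (e.1 + Pi.single e.2 (1 : ℤ) : Site d) j ∧
      (e.1 + Pi.single e.2 (1 : ℤ) : Site d) i - (e.1 + Pi.single e.2 (1 : ℤ) : Site d) j ≤ m + 1 := by
  obtain ⟨h0, hj⟩ := he
  simp only [Pi.add_apply]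
  by_cases hki : i = e.2
  · subst hki
    by_cases hkj : j = e.2
    · subst hkj; constructor <;> omega
    · rw [Pi.single_eq_same, Pi.single_eq_of_ne hkj]; constructor <;> omega
  · rw [Pi.single_eq_of_ne hki]
    by_cases hkj : j = e.2
    · subst hkj
      have := hj rfl
      rw [Pi.single_eq_same]; constructor <;> omega
    · rw [Pi.single_eq_of_ne hkj]; constructor <;> omega

/-- **A diagonal-half cylinder observable lifts to an inner-half torus observable** (every `d`):
if `F` depends only on links `T` of the closed half `diagHalfEdges i j` with `x_i - x_j ≤ m`, and
`m + 2 ≤ L/2`, then `F ∘ torusLift L` is an observable of the inner diagonal half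
`{0 ≤ (y_i - y_j) mod L < L/2}` of `(ℤ/L)^d` (`IsInnerHalfObservable`). -/
theorem isInnerHalfObservable_toTorusObservable {L : ℕ} [NeZero L] {α : Type*}
    {F : LGConfig d G → α} {T : Finset (ZdEdge d)} (hF : IsCylinder F T) {i j : Fin d} {m : ℕ}
    (hT : ∀ e ∈ T, e ∈ diagHalfEdges i j) (hTm : ∀ e ∈ T, e.1 i - e.1 j ≤ m)
    (hmL : m + 2 ≤ L / 2) : IsInnerHalfObservable i j (toTorusObservable L F) := by
  intro U V hUV
  apply hF
  intro e he
  have he' := Finset.mem_coe.1 he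
  have hhalf := hT e he'
  have hm := hTm e he'
  have h0 : 0 ≤ e.1 i - e.1 j := by have := hhalf.1; omega
  have hL2 : (L / 2 : ℕ) ≤ L := Nat.div_le_self L 2
  obtain ⟨h0', hm'⟩ := diag_endpoint_bounds hhalf hm
  have hv := val_torusProj_sub (L := L) i j (x := e.1) h0 (by omega)
  have hv' := val_torusProj_sub (L := L) i j (x := (e.1 + Pi.single e.2 (1 : ℤ) : Site d)) h0'
    (by omega)
  have hs : Literature.MathematicalPhysics.QuantumFieldTheory.Site.shift (Torus.proj L e.1) e.2 =
      Torus.proj L (e.1 + Pi.single e.2 (1 : ℤ) : Site d) := by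
    funext k
    simp only [Literature.MathematicalPhysics.QuantumFieldTheory.Site.shift, Torus.proj_apply,
      Pi.add_apply]
    by_cases hk : k = e.2
    · subst hk
      rw [Pi.single_eq_same, Pi.single_eq_same]; push_cast; ring
    · rw [Pi.single_eq_of_ne hk, Pi.single_eq_of_ne hk]; push_cast; ring
  simp only [torusLift, Function.comp_apply, torusEdge]
  refine hUV _ ?_ ?_
  · have : (((Torus.proj L e.1) i - (Torus.proj L e.1) j).val : ℤ) < (L / 2 : ℕ) := by
      rw [hv]; omega
    exact_mod_cast this
  · rw [hs]
    have : (((Torus.proj L (e.1 + Pi.single e.2 (1 : ℤ) : Site d)) i -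
        (Torus.proj L (e.1 + Pi.single e.2 (1 : ℤ) : Site d)) j).val : ℤ) < (L / 2 : ℕ) := by
      rw [hv']; omega
    exact_mod_cast this

end Support

/-! ## The transfer (every `d`): inner-half diagonal RP of large tori passes to the limit points -/

variable [Group G] [TopologicalSpace G] [IsTopologicalGroup G] [CompactSpace G] [MeasurableSpace G]
  [BorelSpace G] [T2Space G] [SecondCountableTopology G] (ρ : G →* Matrix (Fin N) (Fin N) ℂ)

section Transfer

omit [T2Space G] in
/-- **The diagonal RP pairing of a limit point is non-negative on continuous cylinder observables
of the half `{x_i ≥ x_j}`, provided inner-half diagonal RP holds on all large tori** (every `d`,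
every real `β`): the lift of such an observable to `(ℤ/(L+1))^d` is an inner-half observable for
`L` large (`isInnerHalfObservable_toTorusObservable`), so the torus pairings along the defining
subsequence are eventually non-negative, and so is their limit (real and imaginary parts
separately). -/
theorem integral_diagSwap_nonneg_of_cylinder_of_innerDiagonalRP (hρ : Continuous ρ) {β : ℝ}
    {μ : Measure (LGConfig d G)} (hμ : μ ∈ infiniteVolumeLimitPoints (d := d) ρ β) {i j : Fin d}
    (hRP : ∃ L₀ : ℕ, ∀ L : ℕ, L₀ ≤ L → InnerDiagonalRP (d := d) (L := L + 1) ρ β i j)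
    {F : LGConfig d G → ℂ} {T : Finset (ZdEdge d)} (hFT : IsCylinder F T) (hFc : Continuous F)
    {C : ℝ} (hC : ∀ U, ‖F U‖ ≤ C) (hFS : DependsOn F (diagHalfEdges i j)) :
    0 ≤ ∫ U, conj (F (configDiagSwapZd i j U)) * F U ∂μ := by
  classical
  obtain ⟨φ, hφ, hprob, hconv⟩ := hμ
  haveI := hprob
  obtain ⟨L₀, hL₀⟩ := hRP
  -- support inside the half, with bounded diagonal coordinate
  set T' : Finset (ZdEdge d) := T.filter (· ∈ diagHalfEdges (d := d) i j) with hT'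
  have hFT' : IsCylinder F T' := isCylinder_filter_of_dependsOn hFT hFS
  have hT : ∀ e ∈ T', e ∈ diagHalfEdges i j := fun e he => (Finset.mem_filter.1 he).2
  obtain ⟨m, hm⟩ : ∃ m : ℕ, ∀ e ∈ T', e.1 i - e.1 j ≤ m := by
    refine ⟨T'.sup fun e => (e.1 i - e.1 j).toNat, fun e he => ?_⟩
    have hle := Finset.le_sup (f := fun e : ZdEdge d => (e.1 i - e.1 j).toNat) he
    have : (e.1 i - e.1 j).toNat ≤ T'.sup fun e : ZdEdge d => (e.1 i - e.1 j).toNat := hle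
    omega
  -- the pairing observable and its real and imaginary parts
  set H : LGConfig d G → ℂ := fun U => conj (F (configDiagSwapZd i j U)) * F U with hH
  have hHc : Continuous H :=
    (Complex.continuous_conj.comp (hFc.comp (continuous_configDiagSwapZd i j))).mul hFc
  set TH : Finset (ZdEdge d) :=
    T.image (fun e => (zdDiagSwap i j e.1, Equiv.swap i j e.2)) ∪ T with hTH
  have hHcyl : IsCylinder H TH := by
    intro U V hUV
    have e1 := isCylinder_comp_configDiagSwapZd hFT i j fun e he => hUV e (by
        rw [Finset.coe_union]; exact Or.inl he)
    have e2 := hFT fun e he => hUV e (by rw [Finset.coe_union]; exact Or.inr he)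
    simp only [Function.comp_apply] at e1
    simp only [hH, e1, e2]
  have hHb : ∀ U, ‖H U‖ ≤ C * C := fun U => by
    simp only [hH, norm_mul, Complex.norm_conj]
    exact mul_le_mul (hC _) (hC _) (norm_nonneg _) ((norm_nonneg (F U)).trans (hC U))
  have hre := hconv (fun U => (H U).re) TH
    (fun U V h => by simp only [hHcyl h]) (Complex.continuous_re.comp hHc)
    ⟨C * C, fun U => (Complex.abs_re_le_norm _).trans (hHb U)⟩
  have him := hconv (fun U => (H U).im) TH
    (fun U V h => by simp only [hHcyl h]) (Complex.continuous_im.comp hHc)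
    ⟨C * C, fun U => (Complex.abs_im_le_norm _).trans (hHb U)⟩
  -- the torus pairings are non-negative for large `k`
  have hev : ∀ᶠ k in atTop,
      0 ≤ wilsonExpectation (L := φ k + 1) ρ β (toTorusObservable (φ k + 1) (fun U => (H U).re)) ∧
      wilsonExpectation (L := φ k + 1) ρ β (toTorusObservable (φ k + 1) (fun U => (H U).im)) = 0 := by
    refine Filter.eventually_atTop.2 ⟨2 * m + 8 + L₀, fun k hk => ?_⟩
    have hkφ : k ≤ φ k := hφ.le_apply
    have hmL : m + 2 ≤ (φ k + 1) / 2 := by omega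
    haveI := isProbabilityMeasure_wilsonMeasure (d := d) (L := φ k + 1) (G := G) ρ hρ β
    have hFm' : Measurable (toTorusObservable (φ k + 1) F) :=
      hFc.measurable.comp (measurable_torusLift _)
    have hpos := hL₀ (φ k) (by omega) (toTorusObservable (φ k + 1) F) hFm' ⟨C, fun U => hC _⟩
      (isInnerHalfObservable_toTorusObservable hFT' hT hm hmL)
    have hint : Integrable (toTorusObservable (φ k + 1) H) (wilsonMeasure (L := φ k + 1) ρ β) :=
      Integrable.of_bound ((hHc.comp (continuous_torusLift _)).measurable.aestronglyMeasurable)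
        (C * C) (ae_of_all _ fun U => hHb _)
    have hE : wilsonExpectation (L := φ k + 1) ρ β (fun U : GaugeConfig d (φ k + 1) G =>
        conj (toTorusObservable (φ k + 1) F (configDiagSwap i j U)) *
          toTorusObservable (φ k + 1) F U) =
        wilsonExpectation (L := φ k + 1) ρ β (toTorusObservable (φ k + 1) H) := by
      congr 1
    rw [hE] at hpos
    obtain ⟨h1, h2⟩ := Complex.nonneg_iff.1 hpos
    have hre_eq : (wilsonExpectation (L := φ k + 1) ρ β (toTorusObservable (φ k + 1) H)).re =
        wilsonExpectation (L := φ k + 1) ρ β (toTorusObservable (φ k + 1) fun U => (H U).re) := by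
      simp only [wilsonExpectation]
      exact (integral_re hint).symm
    have him_eq : (wilsonExpectation (L := φ k + 1) ρ β (toTorusObservable (φ k + 1) H)).im =
        wilsonExpectation (L := φ k + 1) ρ β (toTorusObservable (φ k + 1) fun U => (H U).im) := by
      simp only [wilsonExpectation]
      exact (integral_im hint).symm
    exact ⟨hre_eq ▸ h1, (him_eq ▸ h2).symm⟩
  -- pass to the limit
  have hint : Integrable H μ :=
    Integrable.of_bound hHc.measurable.aestronglyMeasurable (C * C) (ae_of_all _ fun U => hHb _)
  have h1 : 0 ≤ ∫ U, (H U).re ∂μ := ge_of_tendsto hre (hev.mono fun k hk => hk.1)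
  have h2 : ∫ U, (H U).im ∂μ = 0 := by
    refine tendsto_nhds_unique him ?_
    exact tendsto_const_nhds.congr' (hev.mono fun k hk => hk.2.symm)
  have hre' : (∫ U, H U ∂μ).re = ∫ U, (H U).re ∂μ := by
    have h := integral_re hint
    simp only [RCLike.re_to_complex] at h
    exact h.symm
  have him' : (∫ U, H U ∂μ).im = ∫ U, (H U).im ∂μ := by
    have h := integral_im hint
    simp only [RCLike.im_to_complex] at h
    exact h.symm
  refine Complex.nonneg_iff.2 ⟨?_, ?_⟩
  · rw [hre']; exact h1
  · rw [him', h2]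

/-- **Inner-half diagonal RP of all large tori implies diagonal RP of the limit points** (every
`d`, every real `β`, `i, j : Fin d`): if `InnerDiagonalRP ρ β i j` holds on `(ℤ/(L+1))^d` for all
`L ≥ L₀`, then every infinite-volume limit point of the torus Wilson states is reflection positive
in the diagonal mirror `x_i = x_j` in the sense of `ClassB.lean` (all bounded measurable
observables of the closed half `{x_i ≥ x_j}`). -/
theorem diagRP_of_mem_infiniteVolumeLimitPoints_of_innerDiagonalRP (hρ : Continuous ρ) {β : ℝ}
    {μ : Measure (LGConfig d G)} (hμ : μ ∈ infiniteVolumeLimitPoints (d := d) ρ β) {i j : Fin d}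
    (hRP : ∃ L₀ : ℕ, ∀ L : ℕ, L₀ ≤ L → InnerDiagonalRP (d := d) (L := L + 1) ρ β i j) :
    IsReflectionPositiveFor (configDiagSwapZd (G := G) i j) (diagHalfEdges i j) μ := by
  obtain ⟨φ, hφ, hprob, hconv⟩ := id hμ
  haveI := hprob
  have hΘ : MeasurePreserving (configDiagSwapZd (G := G) i j) μ μ := by
    rw [configDiagSwapZd_eq_configPerm_swap]
    exact permInvariant_of_mem_infiniteVolumeLimitPoints ρ hρ hμ (Equiv.swap i j)
  exact IsReflectionPositiveFor.of_continuous_cylinder hΘ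
    fun F T hFT hFc ⟨C, hC⟩ hFS =>
      integral_diagSwap_nonneg_of_cylinder_of_innerDiagonalRP ρ hρ hμ hRP hFT hFc hC hFS

/-- **`TorusLimitPointsDiagonalRP d ρ β` follows from inner-half diagonal RP of all large tori**
(every `d`, every real `β`). For `d ≥ 3` the hypothesis is open; for `d = 2` it is a theorem
(`DiagRPTwo.innerDiagonalRP_two_of_three_le` below). -/
theorem torusLimitPointsDiagonalRP_of_innerDiagonalRP (hρ : Continuous ρ) {β : ℝ}
    (hRP : ∀ i j : Fin d, i ≠ j →
      ∃ L₀ : ℕ, ∀ L : ℕ, L₀ ≤ L → InnerDiagonalRP (d := d) (L := L + 1) ρ β i j) :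
    TorusLimitPointsDiagonalRP d ρ β :=
  fun _ hμ _ _ hij => diagRP_of_mem_infiniteVolumeLimitPoints_of_innerDiagonalRP ρ hρ hμ (hRP _ _ hij)

/-- **Class B follows from inner-half diagonal RP of all large tori** (every `d ≥ 1`, `β ≥ 0`). -/
theorem thermodynamicLimitIsClassB_of_innerDiagonalRP [NeZero d] (hρ : Continuous ρ) {β : ℝ}
    (hβ : 0 ≤ β) (hRP : ∀ i j : Fin d, i ≠ j →
      ∃ L₀ : ℕ, ∀ L : ℕ, L₀ ≤ L → InnerDiagonalRP (d := d) (L := L + 1) ρ β i j) :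
    ThermodynamicLimitIsClassB d ρ β :=
  (thermodynamicLimitIsClassB_iff ρ hρ hβ).2 (torusLimitPointsDiagonalRP_of_innerDiagonalRP ρ hρ hRP)

end Transfer

end Summit.QuantumFields.GaugeBoot
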